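import Summits.BirchSwinnertonDyer.Rank1Residual.Supersingular.X6RankZeroLeafHypotheses
import Summits.BirchSwinnertonDyer.Rank1Residual.WAll.Target
import Literature.NumberTheory.EllipticCurves.PlusMinusPAdicLFunctionProofs
import HarnessLib

/-!
# Leaf `ClassX6 ∧ r_an = 0` as the ladder row `WAllCornerX6r0`: binder adapters, the two halves, and
# the value-cell split (cell `bsd-print-x6`, typer seat `ty2`, tranche 2 of the discharge interface)

HONEST FRAMING (cell `bsd-print-x6`, run/shared/lean/pub/bsd-print-x6/README.md): companion of
`Supersingular/X6RankZeroLeafHypotheses.lean` (tranche 1: leaf predicate ⟹ every printed hypothesis of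
every cited theorem, by name). THIS FILE asserts nothing about any curve and introduces NO definition and
NO named fact (debt 0). It connects the leaf's natural closer shape
`∀ W p, p ≠ 2 → ClassX6 W p → W.analyticRank = 0 → BSDp W p` with the W-ALL ladder row
`Summit.BirchSwinnertonDyer.Rank1Residual.WAllCornerX6r0` (`WAll/Target.lean`: the same with a leading
`¬ W.HasCM` binder, redundant on the class by `ClassX6.not_hasCM`) — the `closes_target` of the print
route `PrintX6` — and records, as THEOREMS, the reductions the route's assembly needs:

* §5a pair-level bookkeeping between the typed halves (`Typed.MissingLowerBoundAt` /
  `MissingUpperBoundAt`, existential in the rational value `q` of `#Ш_an`) and the route's NON-UNIT-CELL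
  currency `∀ q, shaAn W = q → padicValRat p q ≠ 0 → padicValRat p q ≤ ord_p #Ш`
  (`padicValRat_le_of_missingLowerBoundAt`, `le_padicValRat_of_missingUpperBoundAt`,
  `missingPPartAt_of_upper_of_nonUnit` — the value-cell split: on a unit value the lower half is free);
* §5b binder adapters `X6RankZero.wallCornerX6r0_of_forall` / `X6RankZero.forall_of_wallCornerX6r0`;
  **the route's ASSEMBLY in kernel form** `X6RankZero.wallCornerX6r0_of_upper_of_eisensteinHalves`
  (class-wide upper half + the bodies of items `EisensteinHalfFiveLe` / `EisensteinHalfAtThree`, verbatim,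
  + GZK ⟹ `WAllCornerX6r0`; prime split by `ClassX6.five_le_or_eq_three`); the row ⟺ the class-wide
  LOWER bound granted Wuthrich 2014 Prop. 21 (`X6RankZero.wallCornerX6r0_iff_forall_missingLowerBoundAt`);
* §5c the Eisenstein-half ITEMS from one-sign `KobayashiLowerDivisibility` class-wide (the K3 crux
  shape, route `SignedLowerHalves` stmt-BirchSwinnertonDyer-19000) with Kobayashi 2003 Thm. 1.2, B. D.
  Kim 2013 Cor. 3.15, modularity, GZK BY NAME and Pollack 2003 the tree theorem
  `pollack_exists_plusMinusPAdicLFunction_holds`: `X6RankZero.padicValRat_le_of_kobayashiLowerDivisibility`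
  (pair), `X6RankZero.eisensteinHalfFiveLe_of_forall_kobayashiLowerDivisibility`,
  `X6RankZero.eisensteinHalfAtThree_of_forall_kobayashiLowerDivisibility` (items, verbatim bodies),
  `X6RankZero.wallCornerX6r0_of_upper_of_forall_kobayashiLowerDivisibility` (row, route inputs),
  `X6RankZero.wallCornerX6r0_of_forall_kobayashiLowerDivisibility` (row, Wuthrich road).
The route's Theses file is NOT imported (its items are spelled out verbatim, so `exact` closes them).

References: `WAll/Target.lean` (row 6); `Typed/X6.lean` (`X6.bsdp_of_missingLowerBoundAt_of_analyticRank_eq_zero`);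
`Supersingular/KobayashiMainConjecture.lean` (`X6.bsdp_of_kobayashiLowerDivisibility_of_analyticRank_eq_zero`);
[Wuthrich2014] Prop. 21; [Kobayashi2003] Thm. 1.2; [BDKim2013] Cor. 3.15; [Pollack2003] Thm. 5.6;
[Miller2011LMS] Def. 1.1; [SilvermanATAEC1994] II.6.4 (CM ⇒ not semistable).
-/

set_option autoImplicit false

noncomputable section

open scoped Classical NumberField

open WeierstrassCurve Literature.NumberTheory.EllipticCurves
  Literature.NumberTheory.EllipticCurves.ModularForms
  Literature.NumberTheory.EllipticCurves.Rank1Residual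
  Literature.NumberTheory.EllipticCurves.Rank1Residual.Typed
  Literature.NumberTheory.EllipticCurves.Wuthrich2014
  Literature.NumberTheory.EllipticCurves.Kobayashi2003

namespace Summit.BirchSwinnertonDyer.Rank1Residual.Supersingular

/-! ### §5a Pair-level bookkeeping of the two halves in the route's «non-unit cell» currency

Route `PrintX6` (cell `bsd-print-x6`) states its Eisenstein-half items on NON-UNIT cells in the shape
`∀ q : ℚ, shaAn W = q → padicValRat p q ≠ 0 → padicValRat p q ≤ ord_p #Ш` and its upper half as
`Typed.MissingUpperBoundAt W p`; the typed halves of `Typed/Basic.lean` are existential in `q`. Since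
the rational value of `#Ш_an` is unique, the currencies are interchangeable: -/

section Halves

variable (W : WeierstrassCurve ℚ) (p : ℕ)

/-- From the typed lower half to the valuation inequality at ANY rational value of `#Ш_an` (the value
is unique). Bookkeeping. [cite: Miller2011LMS, Def. 1.1] -/
theorem padicValRat_le_of_missingLowerBoundAt (hlow : MissingLowerBoundAt W p) (q : ℚ)
    (hq : shaAn W = (q : ℂ)) : padicValRat p q ≤ (padicValNat p W.shaOrder : ℤ) := by
  obtain ⟨q', hq', hle⟩ := hlow
  have hqq : q = q' := by exact_mod_cast hq.symm.trans hq'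
  subst hqq
  exact hle

/-- From the typed upper half to the valuation inequality at ANY rational value of `#Ш_an`.
Bookkeeping. [cite: Miller2011LMS, Def. 1.1] -/
theorem le_padicValRat_of_missingUpperBoundAt (hup : MissingUpperBoundAt W p) (q : ℚ)
    (hq : shaAn W = (q : ℂ)) : (padicValNat p W.shaOrder : ℤ) ≤ padicValRat p q := by
  obtain ⟨q', hq', hle⟩ := hup
  have hqq : q = q' := by exact_mod_cast hq.symm.trans hq'
  subst hqq
  exact hle

/-- **Non-unit-cell currency ⟹ the whole typed output.** The upper half plus the lower inequality on
the NON-UNIT values (`ord_p q ≠ 0`) give `MissingPPartAt W p`: on a unit value (`ord_p q = 0`) the lower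
inequality `0 ≤ ord_p #Ш` is free. This is the value-cell split of the route's assembly, pair level.
[cite: Miller2011LMS, Def. 1.1] -/
theorem missingPPartAt_of_upper_of_nonUnit (hup : MissingUpperBoundAt W p)
    (hlow : ∀ q : ℚ, shaAn W = (q : ℂ) → padicValRat p q ≠ 0 →
      padicValRat p q ≤ (padicValNat p W.shaOrder : ℤ)) : MissingPPartAt W p := by
  obtain ⟨q, hq, hle⟩ := hup
  refine ⟨q, hq, le_antisymm ?_ hle⟩
  by_cases hv : padicValRat p q = 0
  · rw [hv]; exact_mod_cast Nat.zero_le _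
  · exact hlow q hq hv

end Halves

/-! ### §5b The leaf and the ladder row `WAllCornerX6r0` -/

section Target

/-- **Binder adapter.** A closer in the leaf's natural binder order (`p ≠ 2 → ClassX6 W p → r_an = 0 →
BSDp W p`, no CM binder — `ClassX6.not_hasCM` makes it redundant) proves the ladder row
`WAllCornerX6r0`. [folklore] -/
theorem X6RankZero.wallCornerX6r0_of_forall
    (h : ∀ (W : WeierstrassCurve ℚ) [W.IsElliptic] [W.IsGloballyMinimal] (p : ℕ) [Fact p.Prime],
      p ≠ 2 → ClassX6 W p → W.analyticRank = 0 → BSDp W p) :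
    WAllCornerX6r0 :=
  fun W _ _ p _ _ hp hX h0 ↦ h W p hp hX h0

/-- **Binder adapter, converse.** The ladder row gives the leaf closer without the CM binder
(discharged by `ClassX6.not_hasCM`: a semistable curve over `ℚ` has no CM). [cite: SilvermanATAEC1994, Thm. II.6.4 (PDF p. 148)] -/
theorem X6RankZero.forall_of_wallCornerX6r0 (h : WAllCornerX6r0) :
    ∀ (W : WeierstrassCurve ℚ) [W.IsElliptic] [W.IsGloballyMinimal] (p : ℕ) [Fact p.Prime],
      p ≠ 2 → ClassX6 W p → W.analyticRank = 0 → BSDp W p :=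
  fun W _ _ p _ hp hX h0 ↦ h W p (ClassX6.not_hasCM W hX) hp hX h0

/-- **THE ROUTE'S ASSEMBLY, kernel form (value-cell × prime split).** From the class-wide UPPER half
(`hU`, the body of route item `UpperHalfX6` applied to its inputs) and the Eisenstein halves on the
NON-UNIT cells at `p ≥ 5` (`h5`, verbatim the body of item `EisensteinHalfFiveLe`) and at `p = 3` (`h3`,
verbatim the body of item `EisensteinHalfAtThree`), the ladder row `WAllCornerX6r0` follows, GZK
(`hGZK`, a conjunct of `PublishedInputsX6`) turning the typed output into Miller's `BSD(E,p)`
(`bsdp_of_missingPPartAt`): unit cells need no lower half (`missingPPartAt_of_upper_of_nonUnit`), and an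
odd prime on the class is `≥ 5` or `= 3` (`ClassX6.five_le_or_eq_three`). So
`assembly_holds := fun hPub hU h5 h3 ↦ X6RankZero.wallCornerX6r0_of_upper_of_eisensteinHalves <GZK
conjunct of hPub> (hU hPub) h5 h3`. [cite: Miller2011LMS, §1 and Def. 1.1] -/
theorem X6RankZero.wallCornerX6r0_of_upper_of_eisensteinHalves
    (hGZK : rank_eq_analyticRank_of_analyticRank_le_one)
    (hU : ∀ (W : WeierstrassCurve ℚ) [W.IsElliptic] [W.IsGloballyMinimal] (p : ℕ) [Fact p.Prime],
      p ≠ 2 → ClassX6 W p → W.analyticRank = 0 → MissingUpperBoundAt W p)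
    (h5 : ∀ (W : WeierstrassCurve ℚ) [W.IsElliptic] [W.IsGloballyMinimal] (p : ℕ) [Fact p.Prime],
      ¬ W.HasCM → 5 ≤ p → ClassX6 W p → W.analyticRank = 0 →
        ∀ q : ℚ, shaAn W = (q : ℂ) → padicValRat p q ≠ 0 →
          padicValRat p q ≤ (padicValNat p W.shaOrder : ℤ))
    (h3 : ∀ (W : WeierstrassCurve ℚ) [W.IsElliptic] [W.IsGloballyMinimal] (p : ℕ) [Fact p.Prime],
      ¬ W.HasCM → p = 3 → ClassX6 W p → W.analyticRank = 0 →
        ∀ q : ℚ, shaAn W = (q : ℂ) → padicValRat p q ≠ 0 →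
          padicValRat p q ≤ (padicValNat p W.shaOrder : ℤ)) :
    WAllCornerX6r0 := by
  intro W _ _ p _ hcm hp hX h0
  refine bsdp_of_missingPPartAt W p hGZK (by omega)
    (missingPPartAt_of_upper_of_nonUnit W p (hU W p hp hX h0) fun q hq hv ↦ ?_)
  rcases ClassX6.five_le_or_eq_three W p hp hX with h5p | ⟨h3p, -⟩
  · exact h5 W p hcm h5p hX h0 q hq hv
  · exact h3 W p hcm h3p hX h0 q hq hv

/-- **The row from the class-wide LOWER bound (Wuthrich road).** Granted Wuthrich 2014 Prop. 21 (`hW`),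
GZK (`hGZK`) and modularity (`hmod`), a class-wide proof of the signed-IMC lower bound
`MissingLowerBoundAt W p` on the leaf proves `WAllCornerX6r0` (pair by pair:
`X6.bsdp_of_missingLowerBoundAt_of_analyticRank_eq_zero`). [cite: Wuthrich2014, Prop. 21 (p. 400)] [cite: Miller2011LMS, Def. 1.1] -/
theorem X6RankZero.wallCornerX6r0_of_forall_missingLowerBoundAt (hW : sha_dvd_analyticSha)
    (hGZK : rank_eq_analyticRank_of_analyticRank_le_one) (hmod : hasEntireLFunction_rat)
    (hlow : ∀ (W : WeierstrassCurve ℚ) [W.IsElliptic] [W.IsGloballyMinimal] (p : ℕ) [Fact p.Prime],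
      p ≠ 2 → ClassX6 W p → W.analyticRank = 0 → MissingLowerBoundAt W p) :
    WAllCornerX6r0 :=
  fun W _ _ p _ _ hp hX h0 ↦
    X6.bsdp_of_missingLowerBoundAt_of_analyticRank_eq_zero W p hW hGZK hmod hp hX h0 (hlow W p hp hX h0)

/-- **The row IS the class-wide lower bound** (granted Wuthrich Prop. 21, GZK, modularity): the
converse direction is `X6RankZero.missingLowerBoundAt_of_bsdp`. So the print route's `closes_target`
and "the Eisenstein half of the signed main conjecture at every X6 ∧ r_an = 0 pair" are interchangeable.
[cite: Wuthrich2014, Prop. 21 (p. 400)] [cite: Miller2011LMS, Def. 1.1] -/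
theorem X6RankZero.wallCornerX6r0_iff_forall_missingLowerBoundAt (hW : sha_dvd_analyticSha)
    (hGZK : rank_eq_analyticRank_of_analyticRank_le_one) (hmod : hasEntireLFunction_rat) :
    WAllCornerX6r0 ↔
      ∀ (W : WeierstrassCurve ℚ) [W.IsElliptic] [W.IsGloballyMinimal] (p : ℕ) [Fact p.Prime],
        p ≠ 2 → ClassX6 W p → W.analyticRank = 0 → MissingLowerBoundAt W p :=
  ⟨fun h W _ _ p _ hp hX h0 ↦
      X6RankZero.missingLowerBoundAt_of_bsdp W p hGZK h0 (h W p (ClassX6.not_hasCM W hX) hp hX h0),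
    X6RankZero.wallCornerX6r0_of_forall_missingLowerBoundAt hW hGZK hmod⟩

end Target

/-! ### §5c The Eisenstein-half items from Kobayashi's lower divisibility (the K3 crux shape) -/

section Eisenstein

variable (W : WeierstrassCurve ℚ) [W.IsElliptic] [W.IsGloballyMinimal] (p : ℕ) [Fact p.Prime]

/-- **Pair level: `KobayashiLowerDivisibility W p ε` ⟹ the route's non-unit-cell inequality** (indeed at
every value, unit or not): Kobayashi 2003 Thm. 1.2 (`h12`), B. D. Kim 2013 Cor. 3.15 (`hKim`),
modularity (`hmodP`, `hmod`), GZK (`hGZK`) BY NAME, Pollack 2003 the tree theorem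
`pollack_exists_plusMinusPAdicLFunction_holds`; class-level hypotheses (odd good `p`, `a_p = 0`,
`E[p]` irreducible) from `ClassX6`, `L(E,1) ≠ 0` from `r_an = 0`. The tree's
`missingLowerBoundAt_of_kobayashiLowerDivisibility` in the route's currency.
[cite: Kobayashi2003, Thm. 1.2 (p. 2) and (3.6) (p. 7)] [cite: BDKim2013, Cor. 3.15 (p. 199)] [cite: Pollack2003, Thm. 5.6] [cite: Miller2011LMS, Def. 1.1] -/
theorem X6RankZero.padicValRat_le_of_kobayashiLowerDivisibility
    (h12 : thm12_signedSelmerDual_finite_torsion) (hKim : BDKim2013.cor315_signedCharValue_rankZero)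
    (hmodP : nonempty_modularParametrizationData) (hmod : hasEntireLFunction_rat)
    (hGZK : rank_eq_analyticRank_of_analyticRank_le_one)
    (hp : p ≠ 2) (hX : ClassX6 W p) (h0 : W.analyticRank = 0) {ε : ℤˣ}
    (hε : KobayashiLowerDivisibility W p ε) (q : ℚ) (hq : shaAn W = (q : ℂ)) :
    padicValRat p q ≤ (padicValNat p W.shaOrder : ℤ) :=
  padicValRat_le_of_missingLowerBoundAt W p
    (missingLowerBoundAt_of_kobayashiLowerDivisibility W p h12 hKim
      pollack_exists_plusMinusPAdicLFunction_holds hmodP hGZK hp hX.1.1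
      (ClassX6.frobeniusTrace_eq_zero W p hp hX) (ClassX6.irr W p hp hX)
      ((W.analyticRank_eq_zero_iff_holds (hmod W)).1 h0) hε) q hq

end Eisenstein

section EisensteinClasswide

/-- **Item `EisensteinHalfFiveLe` (route PrintX6, crux 2) from one-sign Kobayashi lower divisibility at
every X6 ∧ r_an = 0 pair with `p ≥ 5`** — verbatim the item's body as conclusion; published inputs by
name as in `X6RankZero.padicValRat_le_of_kobayashiLowerDivisibility`. This is the adapter through which
a CONDITIONAL closer (e.g. from the BSTW Thm. 1.3 `p ≥ 5` tier) or an anticyclotomic closer lands the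
item. [cite: Kobayashi2003, Thm. 1.2 and Conjecture (p. 2)] [cite: BDKim2013, Cor. 3.15 (p. 199)] [cite: Miller2011LMS, Def. 1.1] -/
theorem X6RankZero.eisensteinHalfFiveLe_of_forall_kobayashiLowerDivisibility
    (h12 : thm12_signedSelmerDual_finite_torsion) (hKim : BDKim2013.cor315_signedCharValue_rankZero)
    (hmodP : nonempty_modularParametrizationData) (hmod : hasEntireLFunction_rat)
    (hGZK : rank_eq_analyticRank_of_analyticRank_le_one)
    (h : ∀ (W : WeierstrassCurve ℚ) [W.IsElliptic] [W.IsGloballyMinimal] (p : ℕ) [Fact p.Prime],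
      5 ≤ p → ClassX6 W p → W.analyticRank = 0 → ∃ ε : ℤˣ, KobayashiLowerDivisibility W p ε) :
    ∀ (W : WeierstrassCurve ℚ) [W.IsElliptic] [W.IsGloballyMinimal] (p : ℕ) [Fact p.Prime],
      ¬ W.HasCM → 5 ≤ p → ClassX6 W p → W.analyticRank = 0 →
        ∀ q : ℚ, shaAn W = (q : ℂ) → padicValRat p q ≠ 0 →
          padicValRat p q ≤ (padicValNat p W.shaOrder : ℤ) := by
  intro W _ _ p _ _ h5 hX h0 q hq _
  obtain ⟨ε, hε⟩ := h W p h5 hX h0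
  exact X6RankZero.padicValRat_le_of_kobayashiLowerDivisibility W p h12 hKim hmodP hmod hGZK (by omega)
    hX h0 hε q hq

/-- **Item `EisensteinHalfAtThree` (route PrintX6, crux 3, the declared residual) from one-sign
Kobayashi lower divisibility at every X6 ∧ r_an = 0 pair with `p = 3`** (on the class `a_3 = 0` is
automatic: `ClassX6.five_le_or_eq_three`). [cite: Kobayashi2003, Thm. 1.2 and Conjecture (p. 2)] [cite: BDKim2013, Cor. 3.15 (p. 199)] [cite: Miller2011LMS, Def. 1.1] -/
theorem X6RankZero.eisensteinHalfAtThree_of_forall_kobayashiLowerDivisibility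
    (h12 : thm12_signedSelmerDual_finite_torsion) (hKim : BDKim2013.cor315_signedCharValue_rankZero)
    (hmodP : nonempty_modularParametrizationData) (hmod : hasEntireLFunction_rat)
    (hGZK : rank_eq_analyticRank_of_analyticRank_le_one)
    (h : ∀ (W : WeierstrassCurve ℚ) [W.IsElliptic] [W.IsGloballyMinimal] (p : ℕ) [Fact p.Prime],
      p = 3 → ClassX6 W p → W.analyticRank = 0 → ∃ ε : ℤˣ, KobayashiLowerDivisibility W p ε) :
    ∀ (W : WeierstrassCurve ℚ) [W.IsElliptic] [W.IsGloballyMinimal] (p : ℕ) [Fact p.Prime],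
      ¬ W.HasCM → p = 3 → ClassX6 W p → W.analyticRank = 0 →
        ∀ q : ℚ, shaAn W = (q : ℂ) → padicValRat p q ≠ 0 →
          padicValRat p q ≤ (padicValNat p W.shaOrder : ℤ) := by
  intro W _ _ p _ _ h3 hX h0 q hq _
  obtain ⟨ε, hε⟩ := h W p h3 hX h0
  exact X6RankZero.padicValRat_le_of_kobayashiLowerDivisibility W p h12 hKim hmodP hmod hGZK (by omega)
    hX h0 hε q hq

/-- **The row from the K3 crux shape and the route's upper half.** Route `SignedLowerHalves` item
`KobayashiLowerHalfSemistable` (stmt-BirchSwinnertonDyer-19000) reads `∀ W p, p ≠ 2 → ClassX6 W p →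
∃ ε, KobayashiLowerDivisibility W p ε`; with the route's class-wide upper half (`hU`) and the published
inputs by name it closes the row — both Eisenstein items at once. [cite: Kobayashi2003, Thm. 1.2 and Conjecture (p. 2)] [cite: BDKim2013, Cor. 3.15 (p. 199)] [cite: Miller2011LMS, Def. 1.1] -/
theorem X6RankZero.wallCornerX6r0_of_upper_of_forall_kobayashiLowerDivisibility
    (h12 : thm12_signedSelmerDual_finite_torsion) (hKim : BDKim2013.cor315_signedCharValue_rankZero)
    (hmodP : nonempty_modularParametrizationData) (hmod : hasEntireLFunction_rat)
    (hGZK : rank_eq_analyticRank_of_analyticRank_le_one)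
    (hU : ∀ (W : WeierstrassCurve ℚ) [W.IsElliptic] [W.IsGloballyMinimal] (p : ℕ) [Fact p.Prime],
      p ≠ 2 → ClassX6 W p → W.analyticRank = 0 → MissingUpperBoundAt W p)
    (h : ∀ (W : WeierstrassCurve ℚ) [W.IsElliptic] [W.IsGloballyMinimal] (p : ℕ) [Fact p.Prime],
      p ≠ 2 → ClassX6 W p → ∃ ε : ℤˣ, KobayashiLowerDivisibility W p ε) :
    WAllCornerX6r0 :=
  X6RankZero.wallCornerX6r0_of_upper_of_eisensteinHalves hGZK hU
    (X6RankZero.eisensteinHalfFiveLe_of_forall_kobayashiLowerDivisibility h12 hKim hmodP hmod hGZK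
      fun W _ _ p _ h5 hX _ ↦ h W p (by omega) hX)
    (X6RankZero.eisensteinHalfAtThree_of_forall_kobayashiLowerDivisibility h12 hKim hmodP hmod hGZK
      fun W _ _ p _ h3 hX _ ↦ h W p (by omega) hX)

/-- **The row from the K3 crux shape, Wuthrich road** (upper half from Wuthrich 2014 Prop. 21 `hW`
instead of the route's `UpperHalfX6`; pair by pair `X6.bsdp_of_kobayashiLowerDivisibility_of_analyticRank_eq_zero`).
[cite: Wuthrich2014, Prop. 21 (p. 400)] [cite: Kobayashi2003, Thm. 1.2 and Conjecture (p. 2)] [cite: BDKim2013, Cor. 3.15 (p. 199)] -/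
theorem X6RankZero.wallCornerX6r0_of_forall_kobayashiLowerDivisibility (hW : sha_dvd_analyticSha)
    (h12 : thm12_signedSelmerDual_finite_torsion) (hKim : BDKim2013.cor315_signedCharValue_rankZero)
    (hmodP : nonempty_modularParametrizationData) (hmod : hasEntireLFunction_rat)
    (hGZK : rank_eq_analyticRank_of_analyticRank_le_one)
    (h : ∀ (W : WeierstrassCurve ℚ) [W.IsElliptic] [W.IsGloballyMinimal] (p : ℕ) [Fact p.Prime],
      p ≠ 2 → ClassX6 W p → ∃ ε : ℤˣ, KobayashiLowerDivisibility W p ε) :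
    WAllCornerX6r0 := by
  intro W _ _ p _ _ hp hX h0
  obtain ⟨ε, hε⟩ := h W p hp hX
  exact X6.bsdp_of_kobayashiLowerDivisibility_of_analyticRank_eq_zero W p hW h12 hKim
    pollack_exists_plusMinusPAdicLFunction_holds hmodP hmod hGZK hp hX h0 hε

end EisensteinClasswide

end Summit.BirchSwinnertonDyer.Rank1Residual.Supersingular

end
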